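import Literature.GroupTheory.OrbitQuotientTubeCount   -- ★ p843003 (N2a): `orbitRel_comap_subtype_iff`, `natCard_quotient_orbitRel_comap_union`
import HarnessLib

/-!
# Orbit counts `#(S ∕ Φ)` for a TRANSITIVE piece (`= 1`) and for two transitive pieces (`= 2`) — the axis counts of the tube identity
(Serre, *Trees* (1980), I.6.4: the split torus translates its apartment; per period one vertex of each type and two edges)

Topic `GroupTheory`; namespace `Literature.GroupTheory`.  THEOREMS ONLY (no definition, no instance, no notation, no named fact, no `sorry`); Mathlib + ★ (N2a).
Cell `pub/hodgecm-mathlib`, F0∕P3a, crux H413 = stmt-HodgeConjecture-24833, line «N6nsGerm», (R2) Euler–Poincaré road, RAMIFIED half census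
`F0/P3a/A-p06/g27/CENSUS-R2ram-RamifiedEulerPoincare.A-p06g27.md` §4 (N2b) (seat A-p06 (g27)).  HONEST LABEL: HC_CM is proved only modulo the printed citations until
rung 0 closes; pure orbit counting.

In the currency `#(S∕Φ) := Nat.card (Quotient ((MulAction.orbitRel Φ X).comap (Subtype.val : S → X)))` of ★ `natCard_quotient_tube` (whose right-hand side carries
`#(Y_𝓐∕Φ) + #(Y_𝓑∕Φ)` and whose left-hand side carries `#(Fl_Y∕Φ)` — the AXIS terms): when `Φ = τ^ℤ` acts on the apartment of the split torus, the self-dual axis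
vertices form ONE orbit, the `ϖ`-modular axis vertices ONE orbit, the axis flags TWO orbits, so the axis terms cancel (`1 + 1 = 2`) and the tube identity becomes
«`#(F_𝓐∕Φ) + #(F_𝓑∕Φ) = #(Fl∕Φ)`» = Kottwitz's «vertices − edges = 0».

* `natCard_quotient_orbitRel_comap_eq_one` — `S` non-empty and `Φ`-TRANSITIVE (`∀ s t ∈ S, ∃ φ, φ · t = s`) ⇒ `#(S∕Φ) = 1` (and finite).
* `natCard_quotient_orbitRel_comap_eq_two` — `S = S₁ ∪ S₂` with `S₁` invariant, disjoint, each non-empty and transitive ⇒ `#(S∕Φ) = 2`.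
* `natCard_quotient_tube_axis_cancel` — the tube identity with axis counts `1, 1, 2` reads `#(F_𝓐∕Φ) + #(F_𝓑∕Φ) = #(Fl∕Φ)` (arithmetic repackaging).

## References
* [Serre1980Trees] J.-P. Serre, *Trees* (1980), I.6.4 Prop. 24–25; II.1.1.
* [Kottwitz1988] R. E. Kottwitz, *Tamagawa numbers*, Ann. of Math. 127 (1988), §2 Theorem 2.
-/

set_option autoImplicit false

namespace Literature.GroupTheory

variable {Φ : Type*} [Group Φ] {X : Type*} [MulAction Φ X]

/-- **One orbit**: a non-empty `Φ`-transitive `S ⊆ X` has `#(S∕Φ) = 1` (the quotient is a singleton type: finite of cardinality one). [cite: Serre1980Trees, I.6.4] -/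
theorem natCard_quotient_orbitRel_comap_eq_one (S : Set X) (hne : S.Nonempty) (htrans : ∀ s t : S, ∃ φ : Φ, φ • (t : X) = s) :
    Finite (Quotient ((MulAction.orbitRel Φ X).comap (Subtype.val : S → X))) ∧
    Nat.card (Quotient ((MulAction.orbitRel Φ X).comap (Subtype.val : S → X))) = 1 := by
  obtain ⟨s₀, hs₀⟩ := hne
  haveI : Subsingleton (Quotient ((MulAction.orbitRel Φ X).comap (Subtype.val : S → X))) := ⟨fun p q => by
    induction p using Quotient.inductionOn with
    | h a => induction q using Quotient.inductionOn with
      | h b => exact Quotient.sound ((orbitRel_comap_subtype_iff S a b).2 (htrans a b))⟩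
  letI : Inhabited (Quotient ((MulAction.orbitRel Φ X).comap (Subtype.val : S → X))) := ⟨Quotient.mk _ ⟨s₀, hs₀⟩⟩
  haveI : Unique (Quotient ((MulAction.orbitRel Φ X).comap (Subtype.val : S → X))) := Unique.mk' _
  exact ⟨Finite.of_subsingleton, Nat.card_unique⟩

/-- **Two orbits**: `S₁ ∪ S₂` with `S₁` invariant, `S₁ ∩ S₂ = ∅`, each piece non-empty and transitive, has `#((S₁ ∪ S₂)∕Φ) = 2`. [cite: Serre1980Trees, I.6.4] -/
theorem natCard_quotient_orbitRel_comap_eq_two (S₁ S₂ : Set X) (hdisj : Disjoint S₁ S₂) (hinv : ∀ (φ : Φ) (x : X), x ∈ S₁ → φ • x ∈ S₁)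
    (hne₁ : S₁.Nonempty) (hne₂ : S₂.Nonempty) (htrans₁ : ∀ s t : S₁, ∃ φ : Φ, φ • (t : X) = s) (htrans₂ : ∀ s t : S₂, ∃ φ : Φ, φ • (t : X) = s) :
    Finite (Quotient ((MulAction.orbitRel Φ X).comap (Subtype.val : ↥(S₁ ∪ S₂) → X))) ∧
    Nat.card (Quotient ((MulAction.orbitRel Φ X).comap (Subtype.val : ↥(S₁ ∪ S₂) → X))) = 2 := by
  obtain ⟨hf₁, h₁⟩ := natCard_quotient_orbitRel_comap_eq_one (Φ := Φ) S₁ hne₁ htrans₁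
  obtain ⟨hf₂, h₂⟩ := natCard_quotient_orbitRel_comap_eq_one (Φ := Φ) S₂ hne₂ htrans₂
  obtain ⟨hf, h⟩ := natCard_quotient_orbitRel_comap_union (Φ := Φ) S₁ S₂ hdisj hinv hf₁ hf₂
  exact ⟨hf, by rw [h, h₁, h₂]⟩

/-- **Axis cancellation**: if the tube identity `a + b + fY = f + yA + yB` holds with axis counts `yA = 1`, `yB = 1`, `fY = 2`, then `a + b = f` — «per period, fixed
vertices = fixed edges». [cite: Kottwitz1988, §2 Theorem 2] [cite: Serre1980Trees, I.6.4] -/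
theorem natCard_quotient_tube_axis_cancel {a b f fY yA yB : ℕ} (h : a + b + fY = f + yA + yB) (hyA : yA = 1) (hyB : yB = 1) (hfY : fY = 2) : a + b = f := by
  omega

end Literature.GroupTheory
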